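import Mathlib
import HarnessLib
import Summits.Ventures.LatticeQCDFlow.Scaling.Bhattacharyya
import Summits.Ventures.LatticeQCDFlow.Scaling.HierarchicalVolumeLaw
import Literature.Combinatorics.Enumerative.OverwritePositions

/-!
# LatticeQCDFlow / Scaling — the chain rule for the Bhattacharyya coefficient and the acceptance
# volume law for hierarchical / autoregressive models against GENERAL targets (T2-M′, general form)

HONEST FRAMING: exact (Metropolis-corrected) sampling algorithms for lattice gauge theory;
figures of merit are autocorrelation/cost numbers at stated couplings and volumes; no
continuum-physics claim.

Venture `LatticeQCDFlow` (cell pub-lqcd), topic `Scaling`, FANOUT row 30 (lean-1, GEN-15) — OUR WORK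
on THEORY-2.md §4 row T2-M′: "the general-target version needs a CONDITIONAL per-block Hellinger
defect (chain rule for BC) — provable, not done".  The tree has the FACTORISED regime
(`Scaling/Bhattacharyya`: `acc ≤ BC²`, `BC(⊗pᵢ, ⊗qᵢ) = ∏ BC(pᵢ, qᵢ)`, `acc_blockDefect_volume_law`)
and, for hierarchical models `q(c, x) = a(c)·κ_c(x)` (`kerLaw`, `Scaling/HierarchicalVolumeLaw`),
the KL chain rule and the ESS identity (T2-AJ) and the acceptance SANDWICH
(`Scaling/HierarchicalAcceptanceSandwich`: `acc(bρ, aκ) ≤ acc(b, a)`).  Here, finite state spaces,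
non-negative weights:

* **`bhatt_kerLaw_eq`** — the CHAIN RULE `BC(b·ρ, a·κ) = Σ_c √(b_c a_c) · BC(ρ_c, κ_c)`;
  **`bhatt_kerLaw_le`** — if every conditional overlap is `BC(ρ_c, κ_c) ≤ M` then
  `BC(b·ρ, a·κ) ≤ BC(b, a) · M`: the coarse level and the conditional level COMPOUND
  (multiplicatively, like ESS, unlike the additive KL); `bhatt_kerLaw_le_of_coarse_bound` — the
  form to iterate over levels (`BC(b,a) ≤ B ⇒ BC ≤ B·M`), so an `m`-level autoregressive model whose
  every conditional, for every past, has Bhattacharyya overlap `≤ M_ℓ` with the target's has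
  `BC ≤ ∏_ℓ M_ℓ`.
* **`accRate_kerLaw_le_sq`** — `acc(b·ρ, a·κ) ≤ (BC(b,a) · M)²` (tree `accRate_le_bhatt_sq`);
  **`bhatt_le_sqrt_of_tvDist`** — a conditional total-variation DEFECT `δ ≤ TV(ρ_c, κ_c)` gives
  `BC(ρ_c, κ_c) ≤ √(1 − δ²)` (tree Le Cam `bhatt_sq_le`); hence
  **`acc_condDefect_volume_law`** — if at each of `m` levels the conditional law of the target given
  EVERY past is at total variation `≥ δ` from the model's conditional, the independence-sampler
  acceptance obeys `acc ≤ (1 − δ²)^m ≤ e^{−m δ²}`, stated as the one-level step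
  `acc ≤ BC(b,a)²·(1 − δ²)` plus the iteration lemma — the general-target T2-M′: no product
  structure of the TARGET is needed, only a per-level conditional defect uniform in the past.

* §3 the `m`-LEVEL AUTOREGRESSIVE FORM on `Fin m → Z`: `bhatt_peel` (one level:
  `|Z|·BC(P·K, Q·K') ≤ M·BC(P, Q)` when `P, Q` do not read the peeled coordinate — the tree's
  counting identity `Literature.Combinatorics.Enumerative.sum_update_eq`), **`bhatt_autoregressive_le`**
  / `bhatt_autoregressive_le_prod` (`BC(p_m, q_m) ≤ ∏_{n<m} M_n` for laws built level by level with
  conditional overlaps `≤ M_n` for every past), **`acc_autoregressive_volume_law`**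
  (`acc(p_m, q_m) ≤ ∏_{n<m} (1 − δ_n²)` from per-level conditional total-variation defects `δ_n`).

READING (value-free): the acceptance of an exact autoregressive / hierarchical proposal against an
arbitrary target decays at least geometrically in the number of levels carrying a uniform
conditional defect — the acceptance companion of the hierarchical KL / ESS laws (T2-AJ), with the
same physics input (a conditional defect uniform in the volume, hypothesis (U-c) of THEORY-2 §3.1,
NOT asserted here).  NOT CLAIMED: anything about which models carry such a defect; any number of
ours.  Elementary finite sums over the tree's `bhatt`, `accRate`, `kerLaw`, `tvDist`; no definition
is introduced; nothing is cited as a fact; no `sorry`.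
-/

noncomputable section

namespace Summit.Ventures.LatticeQCDFlow.Theory2

open Finset Literature.Probability.MarkovChains
open Summit.Ventures.LatticeQCDFlow.Exactness

variable {C : Type*} [Fintype C] {X : Type*} [Fintype X]

/-! ## §1 The chain rule for the Bhattacharyya coefficient -/

/-- **Chain rule**: `BC(b·ρ, a·κ) = Σ_c √(b_c a_c) · BC(ρ_c, κ_c)` for non-negative coarse weights
(`√(b_c ρ_c(x) · a_c κ_c(x)) = √(b_c a_c) · √(ρ_c(x) κ_c(x))`). [ours] -/
theorem bhatt_kerLaw_eq {b a : C → ℝ} (hb : ∀ c, 0 ≤ b c) (ha : ∀ c, 0 ≤ a c) (ρ κ : C → X → ℝ) :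
    bhatt (kerLaw b ρ) (kerLaw a κ) = ∑ c, Real.sqrt (b c * a c) * bhatt (ρ c) (κ c) := by
  unfold bhatt kerLaw
  rw [Fintype.sum_prod_type]
  refine Finset.sum_congr rfl fun c _ => ?_
  rw [Finset.mul_sum]
  refine Finset.sum_congr rfl fun x _ => ?_
  rw [← Real.sqrt_mul (mul_nonneg (hb c) (ha c))]
  congr 1
  ring

/-- **The two levels compound**: if every conditional overlap is at most `M`, then
`BC(b·ρ, a·κ) ≤ BC(b, a) · M`. [ours] -/
theorem bhatt_kerLaw_le {b a : C → ℝ} (hb : ∀ c, 0 ≤ b c) (ha : ∀ c, 0 ≤ a c) {ρ κ : C → X → ℝ}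
    {M : ℝ} (hcond : ∀ c, bhatt (ρ c) (κ c) ≤ M) :
    bhatt (kerLaw b ρ) (kerLaw a κ) ≤ bhatt b a * M := by
  rw [bhatt_kerLaw_eq hb ha, bhatt, Finset.sum_mul]
  exact Finset.sum_le_sum fun c _ =>
    mul_le_mul_of_nonneg_left (hcond c) (Real.sqrt_nonneg _)

/-- The form to ITERATE over levels: a bound `BC(b, a) ≤ B` on the coarse level and conditional
overlaps `≤ M` give `BC(b·ρ, a·κ) ≤ B · M`. [ours] -/
theorem bhatt_kerLaw_le_of_coarse_bound {b a : C → ℝ} (hb : ∀ c, 0 ≤ b c) (ha : ∀ c, 0 ≤ a c)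
    {ρ κ : C → X → ℝ} {M B : ℝ} (hM : 0 ≤ M) (hcond : ∀ c, bhatt (ρ c) (κ c) ≤ M)
    (hB : bhatt b a ≤ B) : bhatt (kerLaw b ρ) (kerLaw a κ) ≤ B * M :=
  (bhatt_kerLaw_le hb ha hcond).trans (mul_le_mul_of_nonneg_right hB hM)

/-! ## §2 Acceptance: the general-target volume law, one level at a time -/

/-- **Acceptance of a two-level model against a two-level target**:
`acc(b·ρ, a·κ) ≤ (BC(b, a) · M)²` when every conditional overlap is `≤ M` (`acc ≤ BC²`, tree
`accRate_le_bhatt_sq`, and the chain rule). [ours] -/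
theorem accRate_kerLaw_le_sq {b a : C → ℝ} (hb : ∀ c, 0 ≤ b c) (ha : ∀ c, 0 ≤ a c)
    {ρ κ : C → X → ℝ} (hρ : ∀ c x, 0 ≤ ρ c x) (hκ : ∀ c x, 0 ≤ κ c x) {M : ℝ}
    (hcond : ∀ c, bhatt (ρ c) (κ c) ≤ M) :
    accRate (kerLaw b ρ) (kerLaw a κ) ≤ (bhatt b a * M) ^ 2 := by
  have hP : ∀ z, 0 ≤ kerLaw b ρ z := fun z => mul_nonneg (hb _) (hρ _ _)
  have hQ : ∀ z, 0 ≤ kerLaw a κ z := fun z => mul_nonneg (ha _) (hκ _ _)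
  calc accRate (kerLaw b ρ) (kerLaw a κ) ≤ bhatt (kerLaw b ρ) (kerLaw a κ) ^ 2 :=
        accRate_le_bhatt_sq hP hQ
    _ ≤ (bhatt b a * M) ^ 2 :=
        pow_le_pow_left₀ (bhatt_nonneg _ _) (bhatt_kerLaw_le hb ha hcond) 2

/-- **A conditional total-variation defect bounds the conditional overlap** (Le Cam, tree
`bhatt_sq_le`): `δ ≤ TV(ρ_c, κ_c)`, `0 ≤ δ` ⇒ `BC(ρ_c, κ_c) ≤ √(1 − δ²)`. [ours] -/
theorem bhatt_le_sqrt_of_tvDist {p q : X → ℝ} (hp : ∀ x, 0 ≤ p x) (hq : ∀ x, 0 ≤ q x)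
    (hp1 : ∑ x, p x = 1) (hq1 : ∑ x, q x = 1) {δ : ℝ} (hδ : 0 ≤ δ) (hdef : δ ≤ tvDist p q) :
    bhatt p q ≤ Real.sqrt (1 - δ ^ 2) := by
  have h1 : bhatt p q ^ 2 ≤ 1 - δ ^ 2 := by
    have := bhatt_sq_le hp hq hp1 hq1
    have hd : δ ^ 2 ≤ tvDist p q ^ 2 := pow_le_pow_left₀ hδ hdef 2
    linarith
  calc bhatt p q = Real.sqrt (bhatt p q ^ 2) := (Real.sqrt_sq (bhatt_nonneg _ _)).symm
    _ ≤ Real.sqrt (1 - δ ^ 2) := Real.sqrt_le_sqrt h1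

/-- **The general-target acceptance volume law, one level** (T2-M′ without a product target): if the
target `b·ρ` and the model `a·κ` (any coarse laws, any conditional laws, normalised) have at EVERY
coarse value `c` a conditional defect `δ ≤ TV(ρ_c, κ_c)`, then
`acc(b·ρ, a·κ) ≤ BC(b, a)² · (1 − δ²)` — the coarse overlap times a level factor `≤ e^{−δ²}`;
iterating over `m` levels (`bhatt_kerLaw_le_of_coarse_bound`) gives `acc ≤ (1 − δ²)^m ≤ e^{−m δ²}`.
[ours] -/
theorem acc_condDefect_volume_law {b a : C → ℝ} (hb : ∀ c, 0 ≤ b c) (ha : ∀ c, 0 ≤ a c)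
    {ρ κ : C → X → ℝ} (hρ : ∀ c x, 0 ≤ ρ c x) (hκ : ∀ c x, 0 ≤ κ c x)
    (hρ1 : ∀ c, ∑ x, ρ c x = 1) (hκ1 : ∀ c, ∑ x, κ c x = 1) {δ : ℝ} (hδ : 0 ≤ δ) (hδ1 : δ ≤ 1)
    (hdef : ∀ c, δ ≤ tvDist (ρ c) (κ c)) :
    accRate (kerLaw b ρ) (kerLaw a κ) ≤ bhatt b a ^ 2 * (1 - δ ^ 2) := by
  have hcond : ∀ c, bhatt (ρ c) (κ c) ≤ Real.sqrt (1 - δ ^ 2) :=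
    fun c => bhatt_le_sqrt_of_tvDist (hρ c) (hκ c) (hρ1 c) (hκ1 c) hδ (hdef c)
  have h := accRate_kerLaw_le_sq hb ha hρ hκ hcond
  have hsq : Real.sqrt (1 - δ ^ 2) ^ 2 = 1 - δ ^ 2 :=
    Real.sq_sqrt (by nlinarith)
  calc accRate (kerLaw b ρ) (kerLaw a κ) ≤ (bhatt b a * Real.sqrt (1 - δ ^ 2)) ^ 2 := h
    _ = bhatt b a ^ 2 * (1 - δ ^ 2) := by rw [mul_pow, hsq]

/-- The level factor is at most `e^{−δ²}`: `1 − δ² ≤ exp(−δ²)`. [folklore] -/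
theorem one_sub_sq_le_exp_neg_sq (δ : ℝ) : 1 - δ ^ 2 ≤ Real.exp (-δ ^ 2) := by
  have := Real.add_one_le_exp (-δ ^ 2); linarith

/-- **Iterated form**: a coarse bound `BC(b, a)² ≤ A` (e.g. `A = (1 − δ²)^k` from `k` earlier
levels) and a conditional defect `δ` at this level give `acc(b·ρ, a·κ) ≤ A · (1 − δ²)`. [ours] -/
theorem acc_condDefect_volume_law_of_coarse_bound {b a : C → ℝ} (hb : ∀ c, 0 ≤ b c)
    (ha : ∀ c, 0 ≤ a c) {ρ κ : C → X → ℝ} (hρ : ∀ c x, 0 ≤ ρ c x) (hκ : ∀ c x, 0 ≤ κ c x)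
    (hρ1 : ∀ c, ∑ x, ρ c x = 1) (hκ1 : ∀ c, ∑ x, κ c x = 1) {δ : ℝ} (hδ : 0 ≤ δ) (hδ1 : δ ≤ 1)
    (hdef : ∀ c, δ ≤ tvDist (ρ c) (κ c)) {A : ℝ} (hA : bhatt b a ^ 2 ≤ A) :
    accRate (kerLaw b ρ) (kerLaw a κ) ≤ A * (1 - δ ^ 2) :=
  (acc_condDefect_volume_law hb ha hρ hκ hρ1 hκ1 hδ hδ1 hdef).trans
    (mul_le_mul_of_nonneg_right hA (by nlinarith))

/-! ## §3 The `m`-level autoregressive form: `BC ≤ ∏ M_i`, `acc ≤ ∏ (1 − δ_i²)` -/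

section Autoregressive

open Function

variable {Z : Type*} [Fintype Z] {m : ℕ}

/-- **Peeling one autoregressive level.**  On configurations `Fin m → Z`, let `P, Q ≥ 0` not read the
coordinate `s` and `K, K'` be the level-`s` conditionals with overlap `Σ_v √(K K')(z[s ↦ v]) ≤ M`
for every past `z`.  Then `|Z| · BC(P·K, Q·K') ≤ M · BC(P, Q)` (full-space Bhattacharyya sums; the
factor `|Z|` accounts for the coordinate `s` that `P, Q` do not read). [ours] -/
theorem bhatt_peel (s : Fin m) {P Q K K' : (Fin m → Z) → ℝ} (hP : ∀ z, 0 ≤ P z) (hQ : ∀ z, 0 ≤ Q z)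
    (hPs : ∀ z v, P (update z s v) = P z)
    (hQs : ∀ z v, Q (update z s v) = Q z) {M : ℝ}
    (hcond : ∀ z, ∑ v, Real.sqrt (K (update z s v) * K' (update z s v)) ≤ M) :
    (Fintype.card Z : ℝ) * bhatt (fun z => P z * K z) (fun z => Q z * K' z) ≤
      M * bhatt P Q := by
  unfold bhatt
  rw [← Literature.Combinatorics.Enumerative.sum_update_eq s
    (fun z => Real.sqrt (P z * K z * (Q z * K' z))), Fintype.sum_prod_type, Finset.sum_comm,
    Finset.mul_sum]
  refine Finset.sum_le_sum fun z _ => ?_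
  have hsplit : ∀ v, Real.sqrt (P (update z s v) * K (update z s v) *
      (Q (update z s v) * K' (update z s v))) =
      Real.sqrt (P z * Q z) * Real.sqrt (K (update z s v) * K' (update z s v)) := by
    intro v
    rw [hPs, hQs, ← Real.sqrt_mul (mul_nonneg (hP z) (hQ z))]
    congr 1; ring
  simp only [hsplit, ← Finset.mul_sum]
  rw [mul_comm M]
  exact mul_le_mul_of_nonneg_left (hcond z) (Real.sqrt_nonneg _)

/-- **THE `m`-LEVEL AUTOREGRESSIVE BHATTACHARYYA LAW.**  Target and model are built level by level on
`Fin m → Z`: `p_{n+1} = p_n · k_n`, `q_{n+1} = q_n · k'_n` (`n < m`), where the level-`n` laws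
`p_n, q_n ≥ 0` do not read coordinate `n` and the conditionals `k_n, k'_n ≥ 0` have, for EVERY past,
overlap `Σ_v √(k_n k'_n)(z[n ↦ v]) ≤ M_n` (`M_n ≥ 0`).  Then
`|Z|^m · BC(p_m, q_m) ≤ (∏_{n<m} M_n) · BC(p_0, q_0)` (induction on the peeling step). [ours] -/
theorem bhatt_autoregressive_le (p q k k' : ℕ → (Fin m → Z) → ℝ) (M : ℕ → ℝ)
    (hp : ∀ n z, 0 ≤ p n z) (hq : ∀ n z, 0 ≤ q n z) (hM : ∀ n, 0 ≤ M n)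
    (hstep_p : ∀ n (hn : n < m) z, p (n + 1) z = p n z * k n z)
    (hstep_q : ∀ n (hn : n < m) z, q (n + 1) z = q n z * k' n z)
    (hcausal_p : ∀ n (hn : n < m) z v, p n (update z ⟨n, hn⟩ v) = p n z)
    (hcausal_q : ∀ n (hn : n < m) z v, q n (update z ⟨n, hn⟩ v) = q n z)
    (hcond : ∀ n (hn : n < m) z,
      ∑ v, Real.sqrt (k n (update z ⟨n, hn⟩ v) * k' n (update z ⟨n, hn⟩ v)) ≤ M n) :
    (Fintype.card Z : ℝ) ^ m * bhatt (p m) (q m) ≤ (∏ n ∈ Finset.range m, M n) * bhatt (p 0) (q 0) := by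
  -- induction on the number of levels peeled
  have key : ∀ n, n ≤ m →
      (Fintype.card Z : ℝ) ^ n * bhatt (p n) (q n) ≤ (∏ i ∈ Finset.range n, M i) * bhatt (p 0) (q 0) := by
    intro n
    induction n with
    | zero => intro _; simp
    | succ n ih =>
      intro hn
      have hn' : n < m := Nat.lt_of_succ_le hn
      have hpeel := bhatt_peel (⟨n, hn'⟩ : Fin m) (hp n) (hq n) (hcausal_p n hn') (hcausal_q n hn')
        (hcond n hn')
      have hpn : bhatt (p (n + 1)) (q (n + 1)) = bhatt (fun z => p n z * k n z) (fun z => q n z * k' n z) := by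
        unfold bhatt
        refine Finset.sum_congr rfl fun z _ => ?_
        rw [hstep_p n hn', hstep_q n hn']
      have hcard : (0 : ℝ) ≤ (Fintype.card Z : ℝ) ^ n := by positivity
      calc (Fintype.card Z : ℝ) ^ (n + 1) * bhatt (p (n + 1)) (q (n + 1))
          = (Fintype.card Z : ℝ) ^ n * ((Fintype.card Z : ℝ) *
              bhatt (fun z => p n z * k n z) (fun z => q n z * k' n z)) := by rw [hpn, pow_succ]; ring
        _ ≤ (Fintype.card Z : ℝ) ^ n * (M n * bhatt (p n) (q n)) :=
            mul_le_mul_of_nonneg_left hpeel hcard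
        _ = M n * ((Fintype.card Z : ℝ) ^ n * bhatt (p n) (q n)) := by ring
        _ ≤ M n * ((∏ i ∈ Finset.range n, M i) * bhatt (p 0) (q 0)) :=
            mul_le_mul_of_nonneg_left (ih hn'.le) (hM n)
        _ = (∏ i ∈ Finset.range (n + 1), M i) * bhatt (p 0) (q 0) := by
            rw [Finset.prod_range_succ]; ring
  exact key m le_rfl

/-- **Normalised start**: with `p_0 = q_0 = 1` (the empty product), `BC(p_m, q_m) ≤ ∏_{n<m} M_n`.
[ours] -/
theorem bhatt_autoregressive_le_prod [Nonempty Z] (p q k k' : ℕ → (Fin m → Z) → ℝ) (M : ℕ → ℝ)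
    (hp : ∀ n z, 0 ≤ p n z) (hq : ∀ n z, 0 ≤ q n z) (hM : ∀ n, 0 ≤ M n) (hp0 : ∀ z, p 0 z = 1)
    (hq0 : ∀ z, q 0 z = 1)
    (hstep_p : ∀ n (hn : n < m) z, p (n + 1) z = p n z * k n z)
    (hstep_q : ∀ n (hn : n < m) z, q (n + 1) z = q n z * k' n z)
    (hcausal_p : ∀ n (hn : n < m) z v, p n (update z ⟨n, hn⟩ v) = p n z)
    (hcausal_q : ∀ n (hn : n < m) z v, q n (update z ⟨n, hn⟩ v) = q n z)
    (hcond : ∀ n (hn : n < m) z,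
      ∑ v, Real.sqrt (k n (update z ⟨n, hn⟩ v) * k' n (update z ⟨n, hn⟩ v)) ≤ M n) :
    bhatt (p m) (q m) ≤ ∏ n ∈ Finset.range m, M n := by
  have h := bhatt_autoregressive_le p q k k' M hp hq hM hstep_p hstep_q hcausal_p hcausal_q hcond
  have h0 : bhatt (p 0) (q 0) = (Fintype.card Z : ℝ) ^ m := by
    unfold bhatt
    simp [hp0, hq0, Finset.card_univ, Fintype.card_fin]
  rw [h0] at h
  have hpos : (0 : ℝ) < (Fintype.card Z : ℝ) ^ m := by
    have : (0 : ℝ) < Fintype.card Z := by exact_mod_cast Fintype.card_pos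
    positivity
  rw [mul_comm] at h
  exact le_of_mul_le_mul_right h hpos

/-- **THE GENERAL-TARGET ACCEPTANCE VOLUME LAW, `m` LEVELS (T2-M′, autoregressive form).**  If an
exact autoregressive target / model pair on `Fin m → Z` (as in `bhatt_autoregressive_le_prod`) has
at every level `n` and for every past a conditional total-variation defect `δ_n ≤ TV(k_n(z,·), k'_n(z,·))`
between NORMALISED conditionals, then the independence-sampler acceptance obeys
`acc(p_m, q_m) ≤ ∏_{n<m} (1 − δ_n²)` (`≤ exp(−Σ δ_n²)` by `one_sub_sq_le_exp_neg_sq`) — exponential in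
the number of levels carrying a uniform defect, with NO product structure of the target. [ours] -/
theorem acc_autoregressive_volume_law [Nonempty Z] (p q k k' : ℕ → (Fin m → Z) → ℝ) (δ : ℕ → ℝ)
    (hp : ∀ n z, 0 ≤ p n z) (hq : ∀ n z, 0 ≤ q n z) (hk : ∀ n z, 0 ≤ k n z) (hk' : ∀ n z, 0 ≤ k' n z)
    (hp0 : ∀ z, p 0 z = 1) (hq0 : ∀ z, q 0 z = 1)
    (hstep_p : ∀ n (hn : n < m) z, p (n + 1) z = p n z * k n z)
    (hstep_q : ∀ n (hn : n < m) z, q (n + 1) z = q n z * k' n z)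
    (hcausal_p : ∀ n (hn : n < m) z v, p n (update z ⟨n, hn⟩ v) = p n z)
    (hcausal_q : ∀ n (hn : n < m) z v, q n (update z ⟨n, hn⟩ v) = q n z)
    (hk1 : ∀ n (hn : n < m) z, ∑ v, k n (update z ⟨n, hn⟩ v) = 1)
    (hk'1 : ∀ n (hn : n < m) z, ∑ v, k' n (update z ⟨n, hn⟩ v) = 1)
    (hδ : ∀ n, 0 ≤ δ n) (hδ1 : ∀ n, δ n ≤ 1)
    (hdef : ∀ n (hn : n < m) z,
      δ n ≤ tvDist (fun v => k n (update z ⟨n, hn⟩ v)) (fun v => k' n (update z ⟨n, hn⟩ v))) :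
    accRate (p m) (q m) ≤ ∏ n ∈ Finset.range m, (1 - δ n ^ 2) := by
  have hM : ∀ n, 0 ≤ Real.sqrt (1 - δ n ^ 2) := fun n => Real.sqrt_nonneg _
  have hcond : ∀ n (hn : n < m) z, ∑ v, Real.sqrt (k n (update z ⟨n, hn⟩ v) * k' n (update z ⟨n, hn⟩ v)) ≤
      Real.sqrt (1 - δ n ^ 2) := by
    intro n hn z
    exact bhatt_le_sqrt_of_tvDist (fun v => hk n _) (fun v => hk' n _) (hk1 n hn z) (hk'1 n hn z)
      (hδ n) (hdef n hn z)
  have hB := bhatt_autoregressive_le_prod p q k k' (fun n => Real.sqrt (1 - δ n ^ 2)) hp hq hM hp0 hq0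
    hstep_p hstep_q hcausal_p hcausal_q hcond
  calc accRate (p m) (q m) ≤ bhatt (p m) (q m) ^ 2 := accRate_le_bhatt_sq (hp m) (hq m)
    _ ≤ (∏ n ∈ Finset.range m, Real.sqrt (1 - δ n ^ 2)) ^ 2 :=
        pow_le_pow_left₀ (bhatt_nonneg _ _) hB 2
    _ = ∏ n ∈ Finset.range m, (1 - δ n ^ 2) := by
        rw [← Finset.prod_pow]
        refine Finset.prod_congr rfl fun n _ => ?_
        exact Real.sq_sqrt (by nlinarith [hδ n, hδ1 n])

end Autoregressive

end Summit.Ventures.LatticeQCDFlow.Theory2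

end
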